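import Literature.Computability.AlgebraicComplexity.InterfaceMatMulMulti
import Literature.Computability.AlgebraicComplexity.InterfaceMatMulTermsEntropy
import HarnessLib

/-!
# The number of variables of a multi-term matrix multiplication tensor is the product over its terms
(Vassilevska Williams–Xu–Xu–Zhou 2024, Thm. 6.1: `M = ∏_t M_t`, Def. 4.1) — proved

Topic `Literature/Computability/AlgebraicComplexity`.  By Def. 4.1 an interface tensor is the tensor
product of its terms, so the matrix multiplication tensor of a parameter list of `k_t = 0` terms
(`InterfaceMatMulMulti.lean`: `𝒯_{τ,L,ε} ≅ ⟨M, 1, 1⟩`, `M = |mmVars|`) has `M = ∏_t M_t` with `M_t`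
the one-term count of Thm. 6.1 (`mmTermVars`, `InterfaceMatMulTerms.lean`; `M_t = 2^{n_t(H(γ_X) ± o)}
q^{…}` by `vxxz2024_thm61_card/logb`).  This file PROVES the product formula:

* `piFibreEquiv` — `(Fin n → α) ≃ Π_t (Fin n_t → α)`, restricting a chunk map to the chunks of each term
  (`n_t = |τ⁻¹(t)|`, enumerated);
* `completeSplitOn_restrictTo`, `mem_termBlocks_restrictTo_iff` — admissibility for `(τ, L)` is
  admissibility of every restriction for its one-term datum;
* `mem_mmVars_iff_forall`, `card_mmVars_eq_prod` — **`x ∈ mmVars ⇔ ∀ t, x|_t ∈ mmTermVars_t`** and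
  **`|mmVars q τ L ε| = ∏_t |mmTermVars q n_t (L t) ε|`**;
* `mmVars_mono`, `card_mmVars_mono` — the counts grow with `ε` (so the exact `ε = 0` counts of
  `InterfaceMatMulTermsEntropy.lean` bound them from below);
* `card_mmTermVars_zero`, `abs_logb_card_mmTermVars_sub_le`, `logb_card_mmVars_ge` — **the entropy
  form `log₂ M ≥ ∑_t (n_t H(k_t/n_t) + log₂ q ∑_σ k_t(σ) #1's(σ)) − 3^c ∑_t log₂(n_t+1)`** (Thm. 6.1's
  `M = ∏_t 2^{n_t(H(γ_X,t) ± o(1))} q^{…}` for the whole list, terms without chunks contributing `1`).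

Everything is proved; the definitions are `piFibreEquiv`, `restrictTo`, `fibreEmb`; no named facts.

## References

* V. Vassilevska Williams, Y. Xu, Z. Xu, R. Zhou, *New bounds for matrix multiplication: from alpha
  to omega*, SODA 2024, arXiv:2307.07970 (held: `paper:arxiv-2307.07970`), Thm. 6.1 and Def. 4.1.
  [VassilevskaWilliamsXuXuZhou2024]
-/

noncomputable section

open scoped BigOperators
open Finset

namespace Literature.Computability.AlgebraicComplexity

universe u

/-! ## Restricting chunk maps to the chunks of a term -/

section Restrict

variable {n s : ℕ} {α : Type*} (τ : Fin n → Fin s)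

/-- The embedding of the (enumerated) chunks of term `t` into all chunks. [folklore] -/
def fibreEmb (t : Fin s) : Fin (Fintype.card {u // τ u = t}) ↪ Fin n :=
  ⟨fun v => ((Fintype.equivFin {u // τ u = t}).symm v).1, fun _ _ h =>
    (Fintype.equivFin {u // τ u = t}).symm.injective (Subtype.ext h)⟩

/-- The image of the embedding is the fibre. [folklore] -/
theorem fibreEmb_mem (t : Fin s) (v : Fin (Fintype.card {u // τ u = t})) : τ (fibreEmb τ t v) = t :=
  ((Fintype.equivFin {u // τ u = t}).symm v).2

/-- **Restriction of a chunk map to the chunks of term `t`** (enumerated as `Fin n_t`). [cite: VassilevskaWilliamsXuXuZhou2024, Def. 4.1 (the factor T^{⊗n_t}[…] of term t)] -/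
def restrictTo (t : Fin s) (x : Fin n → α) : Fin (Fintype.card {u // τ u = t}) → α := fun v => x (fibreEmb τ t v)

/-- **`(Fin n → α) ≃ Π_t (Fin n_t → α)`**: a chunk map is the family of its restrictions to the terms.
[cite: VassilevskaWilliamsXuXuZhou2024, Def. 4.1 (𝒯 = ⊗_t T^{⊗n_t}[…])] -/
def piFibreEquiv : (Fin n → α) ≃ ((t : Fin s) → Fin (Fintype.card {u // τ u = t}) → α) where
  toFun x := fun t => restrictTo τ t x
  invFun g := fun u => g (τ u) (Fintype.equivFin {u' // τ u' = τ u} ⟨u, rfl⟩)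
  left_inv x := by
    funext u
    simp [restrictTo, fibreEmb]
  right_inv g := by
    have key : ∀ (t : Fin s) (p : {u // τ u = t}),
        g (τ p.1) (Fintype.equivFin {u' // τ u' = τ p.1} ⟨p.1, rfl⟩) = g t (Fintype.equivFin {u // τ u = t} p) := by
      rintro t ⟨w, rfl⟩; rfl
    funext t v
    have h := key t ((Fintype.equivFin {u // τ u = t}).symm v)
    rw [Equiv.apply_symm_apply] at h
    exact h

/-- The restriction map is the forward direction of the equivalence. [folklore] -/
@[simp] theorem piFibreEquiv_apply (x : Fin n → α) (t : Fin s) : piFibreEquiv τ x t = restrictTo τ t x := rfl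

/-- The image of the enumerated chunks of term `t` is the fibre of `t`. [folklore] -/
theorem map_fibreEmb_univ (t : Fin s) : (univ : Finset (Fin (Fintype.card {u // τ u = t}))).map (fibreEmb τ t) = univ.filter fun u => τ u = t := by
  ext u
  simp only [mem_map, mem_univ, true_and, mem_filter]
  constructor
  · rintro ⟨v, rfl⟩; exact fibreEmb_mem τ t v
  · intro hu
    exact ⟨Fintype.equivFin {u' // τ u' = t} ⟨u, hu⟩, by simp [fibreEmb]⟩

/-- The image of a filtered set of enumerated chunks. [folklore] -/
theorem map_fibreEmb_filter (t : Fin s) (p : Fin n → Prop) [DecidablePred p] :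
    ((univ : Finset (Fin (Fintype.card {u // τ u = t}))).filter fun v => p (fibreEmb τ t v)).map (fibreEmb τ t) =
      (univ.filter fun u => τ u = t).filter p := by
  rw [← map_fibreEmb_univ, filter_map]
  rfl

/-- The number of chunks of term `t`. [folklore] -/
theorem card_fibre_eq (t : Fin s) : (univ.filter fun u => τ u = t).card = Fintype.card {u // τ u = t} := by
  rw [← map_fibreEmb_univ, card_map, card_univ, Fintype.card_fin]

end Restrict

/-! ## Admissibility term by term -/

section TermByTerm

variable {q c n s : ℕ} (τ : Fin n → Fin s)

/-- **The split distribution of a restriction is the split distribution on the fibre.** [cite: VassilevskaWilliamsXuXuZhou2024, Def. 3.5] -/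
theorem completeSplitOn_restrictTo (t : Fin s) (I : Fin n → Fin c → Fin 3) :
    completeSplitOn (restrictTo τ t I) univ = completeSplitOn I (univ.filter fun u => τ u = t) := by
  funext σ
  rw [completeSplitOn_apply, completeSplitOn_apply, card_fibre_eq τ t, ← map_fibreEmb_filter τ t (fun u => I u = σ),
    card_map, card_univ, Fintype.card_fin]
  rfl

/-- The level-1 sequence of a restriction is the restriction of the level-1 sequence. [folklore] -/
theorem levelSeq_restrictTo (t : Fin s) (x : Fin n → Fin c → Fin (q + 2)) :
    levelSeq (restrictTo τ t x) = restrictTo τ t (levelSeq x) := rfl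

/-- **Admissibility is admissibility of every restriction** (for the one-term data of the terms).
[cite: VassilevskaWilliamsXuXuZhou2024, Def. 4.1 and Def. 3.6] -/
theorem mem_admissibleSeqs_iff_forall_restrictTo (deg : Fin s → ℕ) (γ : Fin s → (Fin c → Fin 3) → ℝ) (ε : ℝ)
    (I : Fin n → Fin c → Fin 3) :
    I ∈ admissibleSeqs τ deg γ ε ↔
      ∀ t, restrictTo τ t I ∈ admissibleSeqs (fun _ : Fin (Fintype.card {u // τ u = t}) => (0 : Fin 1)) (fun _ => deg t) (fun _ => γ t) ε := by
  simp only [mem_admissibleSeqs]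
  constructor
  · rintro ⟨hlev, hcons⟩ t
    refine ⟨fun v => ?_, fun t₀ hne => ?_⟩
    · have := hlev (fibreEmb τ t v)
      rw [fibreEmb_mem τ t v] at this
      exact this
    · have huniv : (univ.filter fun v : Fin (Fintype.card {u // τ u = t}) => (fun _ => (0 : Fin 1)) v = t₀) = univ := by
        ext v; simp [Subsingleton.elim (0 : Fin 1) t₀]
      rw [huniv] at hne ⊢
      intro σ
      rw [completeSplitOn_restrictTo]
      refine hcons t ?_ σ
      rw [← map_fibreEmb_univ, map_nonempty]
      exact hne
  · intro h
    refine ⟨fun u => ?_, fun t hne σ => ?_⟩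
    · have := (h (τ u)).1 (Fintype.equivFin {u' // τ u' = τ u} ⟨u, rfl⟩)
      simpa [restrictTo, fibreEmb] using this
    · have hne' : (univ.filter fun v : Fin (Fintype.card {u // τ u = t}) => (fun _ => (0 : Fin 1)) v = 0).Nonempty := by
        have huniv : (univ.filter fun v : Fin (Fintype.card {u // τ u = t}) => (fun _ => (0 : Fin 1)) v = 0) = univ := by
          ext v; simp
        rw [huniv, ← map_nonempty (f := fibreEmb τ t), map_fibreEmb_univ]
        exact hne
      have := (h t).2 0 hne' σ
      have huniv : (univ.filter fun v : Fin (Fintype.card {u // τ u = t}) => (fun _ => (0 : Fin 1)) v = 0) = univ := by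
        ext v; simp
      rw [huniv, completeSplitOn_restrictTo] at this
      exact this

/-- `X`-blocks term by term. [cite: VassilevskaWilliamsXuXuZhou2024, Def. 4.1] -/
theorem mem_levelBlocksX_iff_forall (L : Fin s → InterfaceTerm c) (ε : ℝ) (I : Fin n → Fin c → Fin 3) :
    I ∈ levelBlocksX τ L ε ↔ ∀ t, restrictTo τ t I ∈ termBlocksX (Fintype.card {u // τ u = t}) (L t) ε :=
  mem_admissibleSeqs_iff_forall_restrictTo τ (fun t => (L t).i) (fun t => (L t).γX) ε I

/-- `Y`-blocks term by term. [cite: VassilevskaWilliamsXuXuZhou2024, Def. 4.1] -/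
theorem mem_levelBlocksY_iff_forall (L : Fin s → InterfaceTerm c) (ε : ℝ) (I : Fin n → Fin c → Fin 3) :
    I ∈ levelBlocksY τ L ε ↔ ∀ t, restrictTo τ t I ∈ termBlocksY (Fintype.card {u // τ u = t}) (L t) ε :=
  mem_admissibleSeqs_iff_forall_restrictTo τ (fun t => (L t).j) (fun t => (L t).γY) ε I

/-- **`x ∈ mmVars ⇔` every restriction `x|_t` is a variable of the one-term matrix tensor of term `t`.**
[cite: VassilevskaWilliamsXuXuZhou2024, Thm. 6.1 and Def. 4.1] -/
theorem mem_mmVars_iff_forall (L : Fin s → InterfaceTerm c) (ε : ℝ) (x : Fin n → Fin c → Fin (q + 2)) :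
    x ∈ mmVars q τ L ε ↔ ∀ t, restrictTo τ t x ∈ mmTermVars q (Fintype.card {u // τ u = t}) (L t) ε := by
  rw [mem_mmVars, mem_levelBlocksX_iff_forall, mem_levelBlocksY_iff_forall]
  simp only [mem_mmTermVars, levelSeq_restrictTo]
  constructor
  · rintro ⟨hX, hY⟩ t; exact ⟨hX t, hY t⟩
  · intro h; exact ⟨fun t => (h t).1, fun t => (h t).2⟩

/-- **`|mmVars q τ L ε| = ∏_t |mmTermVars q n_t (L t) ε|`** — the number of variables of the matrix
multiplication tensor of a parameter list is the product of the one-term counts. [cite: VassilevskaWilliamsXuXuZhou2024, Thm. 6.1 and Def. 4.1] -/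
theorem card_mmVars_eq_prod (L : Fin s → InterfaceTerm c) (ε : ℝ) :
    (mmVars q τ L ε).card = ∏ t, (mmTermVars q (Fintype.card {u // τ u = t}) (L t) ε).card := by
  classical
  rw [← Fintype.card_piFinset]
  refine card_bij (fun x _ => piFibreEquiv τ x) (fun x hx => ?_) (fun x _ y _ h => (piFibreEquiv τ).injective h)
    (fun g hg => ⟨(piFibreEquiv τ).symm g, ?_, (piFibreEquiv τ).apply_symm_apply g⟩)
  · exact Fintype.mem_piFinset.2 fun t => (mem_mmVars_iff_forall τ L ε x).1 hx t
  · refine (mem_mmVars_iff_forall τ L ε _).2 fun t => ?_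
    have := Fintype.mem_piFinset.1 hg t
    rw [← piFibreEquiv_apply, Equiv.apply_symm_apply]
    exact this

/-! ### Monotonicity in `ε` -/

/-- The variables grow with the tolerance. [cite: VassilevskaWilliamsXuXuZhou2024, Def. 3.6] -/
theorem mmVars_mono (L : Fin s → InterfaceTerm c) {ε ε' : ℝ} (h : ε ≤ ε') : mmVars q τ L ε ⊆ mmVars q τ L ε' := by
  intro x hx
  rw [mem_mmVars] at hx ⊢
  exact ⟨levelBlocksX_mono τ L h hx.1, levelBlocksY_mono τ L h hx.2⟩

/-- Hence the counts grow with the tolerance. [cite: VassilevskaWilliamsXuXuZhou2024, Def. 3.6] -/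
theorem card_mmVars_mono (L : Fin s → InterfaceTerm c) {ε ε' : ℝ} (h : ε ≤ ε') :
    (mmVars q τ L ε).card ≤ (mmVars q τ L ε').card :=
  card_le_card (mmVars_mono τ L h)

end TermByTerm

/-! ## The entropy form of the count -/

section Entropy

variable {q c n s : ℕ} (τ : Fin n → Fin s)

/-- A term without chunks has exactly one (empty) variable. [folklore] -/
theorem card_mmTermVars_zero (T : InterfaceTerm c) (ε : ℝ) : (mmTermVars q 0 T ε).card = 1 := by
  have h : mmTermVars q 0 T ε = univ := by
    ext x
    simp only [mem_mmTermVars, mem_univ, iff_true]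
    constructor <;>
    · exact mem_admissibleSeqs.2 ⟨fun u => u.elim0, fun t hne => absurd hne (by simp)⟩
  rw [h, card_univ]
  simp

/-- **Thm. 6.1's count in entropy form, for any number of chunks** (`n = 0`: both sides vanish).
[cite: VassilevskaWilliamsXuXuZhou2024, Thm. 6.1 and Lemma 3.3] -/
theorem abs_logb_card_mmTermVars_sub_le (hq : 0 < q) (n : ℕ) (T : InterfaceTerm c) (hij : T.i + T.j = 2 * c)
    (hγ : ∀ σ : Fin c → Fin 3, T.γY σ = T.γX (fun p => (σ p).rev)) (k : (Fin c → Fin 3) → ℕ)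
    (hk : ∀ σ, (k σ : ℝ) = n * T.γX σ) (hsupp : ∀ σ, k σ ≠ 0 → patternLevel σ = T.i) (hsum : ∑ σ, k σ = n) :
    |Real.logb 2 ((mmTermVars q n T 0).card) -
        ((n : ℝ) * shannonEntropy (fun σ => (k σ : ℝ) / n) +
          Real.logb 2 q * ∑ σ, (k σ : ℝ) * ((univ.filter fun p : Fin c => σ p = 1).card : ℝ))| ≤
      (3 : ℝ) ^ c * Real.logb 2 ((n : ℝ) + 1) := by
  rcases Nat.eq_zero_or_pos n with rfl | hn
  · have hk0 : ∀ σ, k σ = 0 := fun σ => (Finset.sum_eq_zero_iff.1 hsum) σ (mem_univ _)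
    simp [card_mmTermVars_zero, hk0]
  · exact vxxz2024_thm61_logb hq hn T hij hγ k hk hsupp hsum

/-- **`log₂ M ≥ ∑_t (n_t H(k_t/n_t) + log₂ q · ∑_σ k_t(σ) #1's(σ)) − 3^c ∑_t log₂(n_t + 1)`** for the number
`M = |mmVars q τ L ε|` of `X`-variables of the matrix multiplication tensor of a parameter list of
`k_t = 0` terms (`ε ≥ 0`; `k_t = n_t γ_{X,t}` the integral types, `γ_{Y,t}` the reversed `γ_{X,t}`,
`i_t + j_t = 2c`): the product of the printed `M_t = 2^{n_t(H(γ_{X,t}) ± o(1))} q^{n_t ∑_σ γ_{X,t}(σ) #1's(σ)}`.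
[cite: VassilevskaWilliamsXuXuZhou2024, Thm. 6.1, Lemma 3.3 and Def. 4.1] -/
theorem logb_card_mmVars_ge (hq : 0 < q) (L : Fin s → InterfaceTerm c) {ε : ℝ} (hε : 0 ≤ ε)
    (hij : ∀ t, (L t).i + (L t).j = 2 * c) (hγ : ∀ t (σ : Fin c → Fin 3), (L t).γY σ = (L t).γX (fun p => (σ p).rev))
    (k : Fin s → (Fin c → Fin 3) → ℕ) (hk : ∀ t σ, (k t σ : ℝ) = Fintype.card {u // τ u = t} * (L t).γX σ)
    (hsupp : ∀ t σ, k t σ ≠ 0 → patternLevel σ = (L t).i) (hsum : ∀ t, ∑ σ, k t σ = Fintype.card {u // τ u = t}) :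
    ∑ t, ((Fintype.card {u // τ u = t} : ℝ) * shannonEntropy (fun σ => (k t σ : ℝ) / Fintype.card {u // τ u = t}) +
          Real.logb 2 q * ∑ σ, (k t σ : ℝ) * ((univ.filter fun p : Fin c => σ p = 1).card : ℝ)) -
        (3 : ℝ) ^ c * ∑ t, Real.logb 2 ((Fintype.card {u // τ u = t} : ℝ) + 1) ≤
      Real.logb 2 ((mmVars q τ L ε).card) := by
  -- at `ε = 0`
  have hpos : ∀ t, (0 : ℝ) < (mmTermVars q (Fintype.card {u // τ u = t}) (L t) 0).card := by
    intro t
    rcases Nat.eq_zero_or_pos (Fintype.card {u // τ u = t}) with h0 | hn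
    · rw [h0, card_mmTermVars_zero]; norm_num
    · rw [vxxz2024_thm61_card hn (L t) (hij t) (hγ t) (k t) (hk t) (hsupp t) (hsum t)]
      exact_mod_cast Nat.mul_pos (Nat.multinomial_pos _ _) (pow_pos hq _)
  have h0 : Real.logb 2 ((mmVars q τ L 0).card) =
      ∑ t, Real.logb 2 ((mmTermVars q (Fintype.card {u // τ u = t}) (L t) 0).card) := by
    rw [card_mmVars_eq_prod]
    push_cast
    exact Real.logb_prod _ _ fun t _ => (hpos t).ne'
  have hterm : ∀ t, (Fintype.card {u // τ u = t} : ℝ) * shannonEntropy (fun σ => (k t σ : ℝ) / Fintype.card {u // τ u = t}) +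
        Real.logb 2 q * ∑ σ, (k t σ : ℝ) * ((univ.filter fun p : Fin c => σ p = 1).card : ℝ) -
        (3 : ℝ) ^ c * Real.logb 2 ((Fintype.card {u // τ u = t} : ℝ) + 1) ≤
      Real.logb 2 ((mmTermVars q (Fintype.card {u // τ u = t}) (L t) 0).card) := by
    intro t
    have h := abs_logb_card_mmTermVars_sub_le hq (Fintype.card {u // τ u = t}) (L t) (hij t) (hγ t) (k t) (hk t) (hsupp t) (hsum t)
    rw [abs_le] at h
    linarith [h.1]
  -- monotonicity in `ε`
  have hmono : Real.logb 2 ((mmVars q τ L 0).card) ≤ Real.logb 2 ((mmVars q τ L ε).card) := by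
    have hc0 : (0 : ℝ) < (mmVars q τ L 0).card := by
      rw [card_mmVars_eq_prod]; push_cast; exact prod_pos fun t _ => hpos t
    exact Real.logb_le_logb_of_le one_lt_two hc0 (by exact_mod_cast card_mmVars_mono τ L hε)
  refine le_trans ?_ hmono
  rw [h0, mul_sum, ← sum_sub_distrib]
  exact sum_le_sum fun t _ => hterm t

end Entropy

end Literature.Computability.AlgebraicComplexity
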